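import Summits.AtomisticToContinuum.Crystallization.Theorems.FluxTubeKeplerFloorGivesLayered
import Summits.AtomisticToContinuum.Crystallization.Theorems.FluxTubeKeplerFluxCellKeplerSingleScale
import Summits.AtomisticToContinuum.Crystallization.Theorems.ChessboardParticlePlanesPeriodicWindowsIffCrystallization

/-!
# G26 — forward rung generator over `FluxTubeKepler.FloorGivesLayered`: CLOSURE OF THE RADIUS DIAL
# (banked Lean for the found-nothing census `Lines/G26FoundNothing.md`; NOT a registered line)

Crux `stmt-AtomisticToContinuum-15221` (`FluxTubeKepler.FluxCellKepler`), seed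
g1-AtomisticToContinuum-15223 = `Theorems.FluxTubeKeplerFloorGivesLayered.FloorGivesLayered_proof`
(FLOOR(P₀) ∧ layered-defect BUDGET at every radius ⇒ layered windows), forward generator G1, generation 26.

This seat's independently derived candidate rung was the RADIUS dial at `R₀ = 4`:
`RadiusFourRung := RadiusRung {4}` — FLOOR(P₀) and the defect budget certified ONLY at pattern radius 4
(all tolerances) already force periodic windows, the intended new input being potential-free chart gluing
for the crux's relaxed-Barlow defect predicate.  The radius dial is gen 3's family
(`Lines/FirstShellRung.lean`, namespace `…Cruxes.FluxCellKepler.RadiusLadder`, deciding rung `RadiusRung {6/5}`),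
and the gluing is LANDED (`Theorems.FluxCellKeplerSingleScale.good_of_locallyGood` / `card_bad_le`, sorry-free,
for every base radius `R₀ ≥ 2`).  Gen 3 recorded the consequence only at `R₀ = 2` (`radiusRung_two`).

This file proves the candidate OUTRIGHT and closes the whole upper part of the dial:

* `radiusRung_singleton` — `RadiusRung {R₀}` is a THEOREM for every `R₀ ≥ 2`;
* `radiusRung_of_exists_mem` — `RadiusRung 𝓡` is a theorem for every radius set `𝓡` meeting `[2, ∞)`;
* `radiusFourRung_holds` — the g26 candidate, hence `rejected: RadiusFourRung(costume — provable from landed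
  inputs)`.

So on the radius axis the only rungs over this floor that are NOT theorems are `RadiusRung 𝓡` with
`𝓡 ⊆ (0, 2)` (gen 3's `FirstShellRung = RadiusRung {6/5}`, open stub `stub_firstShellGluing`) and `𝓡 ∩ (0,∞) = ∅`
(FLOOR alone ⇒ windows: summit-strength, never filed).  The family, the floor specialisation (F3) and the
on-path lemma (F4) are re-declared verbatim from gen 3 so that this file elaborates on its own.
No `sorry`.
-/

noncomputable section

open scoped BigOperators Classical
open Filter Topology

namespace Summit.AtomisticToContinuum.Crystallization.Cruxes.FluxCellKepler.RadiusLadderClosure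

open Literature.MathematicalPhysics.StatisticalMechanics
open Summit.AtomisticToContinuum.Crystallization.Theorems.FluxCellKeplerSingleScale
  (LayeredGood layeredGood_mono card_bad_le)

local notation "E3" => EuclideanSpace ℝ (Fin 3)

/-! ## The radius ladder (verbatim gen 3, `Lines/FirstShellRung.lean`) -/

/-- FLOOR(P₀): `N · e(P₀) ≤ E(x)` for every Lennard-Jones ground state `x` of every size `N`. -/
def Floor (P₀ : PeriodicConfiguration 3) : Prop :=
  ∀ (N : ℕ) (x : Fin N → E3), IsGroundState lennardJones x →
    (N : ℝ) * P₀.energyPerParticle lennardJones ≤ interactionEnergy lennardJones x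

/-- BUDGET(P₀) on the radius set `𝓡`: for every `R ∈ 𝓡`, `R > 0`, and every `η > 0`, some `c > 0` prices
the `(R,η)`-non-layered sites of every ground state against the excess energy over `N · e(P₀)`. -/
def Budget (𝓡 : Set ℝ) (P₀ : PeriodicConfiguration 3) : Prop :=
  ∀ R η : ℝ, 0 < R → R ∈ 𝓡 → 0 < η → ∃ c : ℝ, 0 < c ∧
    ∀ (N : ℕ) (x : Fin N → E3), IsGroundState lennardJones x →
      c * (Nat.card {i : Fin N // ¬ LayeredGood R η x i} : ℝ) ≤
        interactionEnergy lennardJones x - (N : ℝ) * P₀.energyPerParticle lennardJones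

/-- Periodic windows at every scale along the sequence `x` (one periodic `P`, translations only). -/
def HasPeriodicWindows (x : (N : ℕ) → (Fin N → E3)) : Prop :=
  ∃ P : PeriodicConfiguration 3, ∀ R ε : ℝ, 0 < ε → ∃ᶠ N in atTop, ∃ t : E3,
    (∀ s ∈ P.points, ‖s‖ ≤ R → ∃ i : Fin N, dist (x N i + t) s ≤ ε) ∧
    (∀ i : Fin N, ‖x N i + t‖ ≤ R → ∃ s ∈ P.points, dist (x N i + t) s ≤ ε)

/-- `RadiusRung 𝓡`: FLOOR and the defect budget at the radii in `𝓡` force periodic windows along every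
Lennard-Jones ground-state sequence. -/
def RadiusRung (𝓡 : Set ℝ) : Prop :=
  ∀ P₀ : PeriodicConfiguration 3, Floor P₀ → Budget 𝓡 P₀ →
    ∀ x : (N : ℕ) → (Fin N → E3), (∀ N, IsGroundState lennardJones (x N)) → HasPeriodicWindows x

/-- **The g26 candidate rung**: the budget certified only at pattern radius `4`. -/
def RadiusFourRung : Prop := RadiusRung {4}

/-! ## F3 — the family specialises to the proved floor -/

/-- `RadiusRung univ` is the floor followed by the proved `PeriodicGivenLayered`. -/
theorem radiusRung_univ : RadiusRung Set.univ := fun P₀ hF hB x hx =>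
  Theses.FluxTubeKepler.PeriodicGivenLayered_holds x hx
    (Theorems.FluxTubeKeplerFloorGivesLayered.FloorGivesLayered_proof P₀ hF
      (fun R η hR hη => hB R η hR (Set.mem_univ R) hη) x hx)

/-- Antitonicity of the dial: fewer radii assumed = stronger statement. -/
theorem radiusRung_mono {𝓡 𝓡' : Set ℝ} (h : 𝓡 ⊆ 𝓡') : RadiusRung 𝓡 → RadiusRung 𝓡' :=
  fun H P₀ hF hB x hx => H P₀ hF (fun R η hR hR𝓡 hη => hB R η hR (h hR𝓡) hη) x hx

/-! ## F4 — on path -/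

/-- `Crystallization → RadiusRung 𝓡` for every `𝓡` (landed hull-criterion converse). -/
theorem radiusRung_of_crystallization (𝓡 : Set ℝ) (h : _root_.Crystallization) : RadiusRung 𝓡 :=
  fun _ _ _ x hx =>
    Theorems.ChessboardParticlePlanesPeriodicWindowsIffCrystallization.periodicWindows_of_crystallization h x hx

@[aesop safe apply]
theorem RadiusFourRung_of_Crystallization (h : _root_.Crystallization) : RadiusFourRung :=
  radiusRung_of_crystallization _ h

/-! ## The closure: every singleton `{R₀}` with `R₀ ≥ 2` is a theorem -/

/-- The budget at one radius `R₀` gives the budget at every radius `R ≤ R₀` with the same constant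
(`layeredGood_mono`). -/
theorem budget_le_of_singleton {R₀ : ℝ} {P₀ : PeriodicConfiguration 3} (hB : Budget {R₀} P₀)
    {R η : ℝ} (hR : 0 < R) (hRR₀ : R ≤ R₀) (hη : 0 < η) :
    ∃ c : ℝ, 0 < c ∧ ∀ (N : ℕ) (x : Fin N → E3), IsGroundState lennardJones x →
      c * (Nat.card {i : Fin N // ¬ LayeredGood R η x i} : ℝ) ≤
        interactionEnergy lennardJones x - (N : ℝ) * P₀.energyPerParticle lennardJones := by
  obtain ⟨c, hc, hcb⟩ := hB R₀ η (hR.trans_le hRR₀) rfl hη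
  refine ⟨c, hc, fun N x hx => ?_⟩
  have hle : Nat.card {i : Fin N // ¬ LayeredGood R η x i} ≤
      Nat.card {i : Fin N // ¬ LayeredGood R₀ η x i} := by
    rw [Nat.card_eq_fintype_card, Nat.card_eq_fintype_card]
    exact Fintype.card_subtype_mono _ _ fun i hi hg => hi (layeredGood_mono hRR₀ x i hg)
  have hmono : (Nat.card {i : Fin N // ¬ LayeredGood R η x i} : ℝ) ≤
      Nat.card {i : Fin N // ¬ LayeredGood R₀ η x i} := by exact_mod_cast hle
  exact (mul_le_mul_of_nonneg_left hmono hc.le).trans (hcb N x hx)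

/-- **The budget at ONE radius `R₀ ≥ 2` gives the budget at every radius**: below `R₀` by radius
monotonicity, above `R₀` by the landed potential-free gluing-and-counting `card_bad_le` (base radius `R₀`)
on ground states, which are uniformly separated (`LennardJonesMinimalDistance_holds`). -/
theorem budget_univ_of_singleton {R₀ : ℝ} (hR₀ : 2 ≤ R₀) {P₀ : PeriodicConfiguration 3}
    (hB : Budget {R₀} P₀) : Budget Set.univ P₀ := by
  intro R η hR _ hη
  by_cases hRR₀ : R ≤ R₀
  · exact budget_le_of_singleton hB hR hRR₀ hη
  · obtain ⟨δ, hδ, hsep⟩ := LennardJonesMinimalDistance_holds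
    obtain ⟨η', hη', M, hM, hcount⟩ := card_bad_le hR₀ hδ R η hη
    obtain ⟨c, hc, hcb⟩ := hB R₀ η' (by linarith) rfl hη'
    refine ⟨c / M, div_pos hc hM, fun N x hx => ?_⟩
    have h1 := hcount N x (hsep N x hx)
    have h2 := hcb N x hx
    calc c / M * (Nat.card {i : Fin N // ¬ LayeredGood R η x i} : ℝ)
        ≤ c / M * (M * Nat.card {i : Fin N // ¬ LayeredGood R₀ η' x i}) :=
          mul_le_mul_of_nonneg_left h1 (div_pos hc hM).le
      _ = c * Nat.card {i : Fin N // ¬ LayeredGood R₀ η' x i} := by field_simp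
      _ ≤ _ := h2

/-- **`RadiusRung {R₀}` is a theorem for every `R₀ ≥ 2`.** -/
theorem radiusRung_singleton {R₀ : ℝ} (hR₀ : 2 ≤ R₀) : RadiusRung {R₀} := fun P₀ hF hB x hx =>
  radiusRung_univ P₀ hF (budget_univ_of_singleton hR₀ hB) x hx

/-- **Every radius set meeting `[2, ∞)` gives a theorem.** -/
theorem radiusRung_of_exists_mem {𝓡 : Set ℝ} (h : ∃ R₀ ∈ 𝓡, 2 ≤ R₀) : RadiusRung 𝓡 := by
  obtain ⟨R₀, hR₀𝓡, hR₀⟩ := h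
  exact radiusRung_mono (Set.singleton_subset_iff.2 hR₀𝓡) (radiusRung_singleton hR₀)

/-- **The g26 candidate is a theorem** (`costume`: floor + landed gluing, no new input). -/
theorem radiusFourRung_holds : RadiusFourRung :=
  radiusRung_singleton (by norm_num)

/-- Sanity: the closed half-line version. -/
theorem radiusRung_Ici_two : RadiusRung (Set.Ici 2) :=
  radiusRung_of_exists_mem ⟨2, Set.self_mem_Ici, le_rfl⟩

end Summit.AtomisticToContinuum.Crystallization.Cruxes.FluxCellKepler.RadiusLadderClosure

end
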